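import Summits.MatrixMultiplication.MatrixMultiplication.Theses.LevelGradedCohnUmans
import Summits.MatrixMultiplication.MatrixMultiplication.Theorems.LevelTwoBeatsCubes.Negative.GradedNeumannCount
import Summits.MatrixMultiplication.MatrixMultiplication.Theorems.GradedPricing.Negative.LoadBearing
import Summits.MatrixMultiplication.MatrixMultiplication.Theorems.GradedPricing.Negative.AbelianHosts
import Summits.MatrixMultiplication.MatrixMultiplication.Theorems.LevelGradedCohnUmansGradedPricing
import Literature.RepresentationTheory.FiniteGroups.IrreducibleCharacters
import Literature.RepresentationTheory.FiniteGroups.NumberOfIrreducibles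
import Literature.RepresentationTheory.FiniteGroups.BrauerTheorem
import Literature.Computability.AlgebraicComplexity.BCGPUInfiniteGroupsProofs
import Summits.MatrixMultiplication.MatrixMultiplication.Statement

/-!
# Disproof of `GradedDesignFamily` — findings (cdisprove seat, crux `stmt-MatrixMultiplication-7610`)

Crux (route `LevelGradedCohnUmans`, TARGET, rank 0), informally: for every `ε > 0` there are a
finite group `G`, a BI-INVARIANT test space `J ≤ ℂ^G` and a `J`-SEPARATED triple `X, Y, Z ⊆ G`
with  `Σᶠ_{χ ∈ Irr(G) ∩ J} χ(1)^(2+ε) < (|X||Y||Z|)^((2+ε)/3)`  (graded Cohn–Umans designs).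

## Verdict after cycle 1 (2026-08-16): NO KILL — an honest open problem; everything below is
kernel-checked (`sorry`-free, axioms `propext`/`Classical.choice`/`Quot.sound`).

* §0 READING / JUNK AUDIT — `gradedDesignFamily_iff` (`Iff.rfl` through `BiInv`, `Sep`, `budget`,
  `vol`, `Witness`); the budget is a genuine finite sum of `d^(2+ε)`, `d ≥ 1` (`budget_eq_sum`,
  `one_le_re_apply_one`, `budget_mono`); a witness has `V > 0` (`vol_pos_of_witness`),
  `dim J ≥ 2` (`two_le_finrank_of_witness`) and `≥ 2` visible irreducibles (`two_le_nblocks`).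
* §1 LOAD-BEARING CONSTRAINTS — drop any one and the family becomes TRIVIALLY realizable in `Z/2`:
  `realizable_without_biInv` (`J = ℂ·δ_g`, budget `0`), `realizable_without_zeros` (constants),
  `realizable_without_ones` (`J = ⊥`), `realizable_with_le` (`≤` for `<`: `1 ≤ 1`).  RANGE OF `ε`:
  `witness_of_one_lt` — every `ε > 1` is realized by the trivial `Z/2` matrix–vector design, and
  `exists_abelian_witness_iff` — abelian hosts realize `ε` IFF `ε > 1` (with the sibling's
  `gradedDesignFamily_no_abelian_witness`): the crux lives in `0 < ε ≤ 1`, non-abelian hosts only.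
* §2 THE EXPONENT-2 ENDPOINT — walls `V² ≤ (dim J)³` (graded Neumann count of crux 7612) and the
  Peter–Weyl dimension bound `dim J ≤ Σ_{χ ∈ Irr ∩ J} χ(1)²` (`finrank_le_budget_two`, from the
  landed transfer `le_repFun_charSupport` of the PROVED sibling crux `GradedPricing`) give
  `V^(2/3) ≤ budget₂` in every group (`rpow_vol_le_budget_two`): NO witness at `ε = 0`
  (`not_witness_zero`); the crux with `0 ≤ ε` for `0 < ε` is FALSE (`not_gradedDesignFamily_closed`).
* §3 THE GRADED PACKING LAW — sharper wall `2V² ≤ (dim J)³` once `dim J ≥ 2`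
  (`two_mul_vol_sq_le_finrank_cube`); power mean `budget₂^((2+ε)/2) ≤ N^(ε/2) budget_(2+ε)`;
  hence for EVERY witness at `ε`: `N^ε > 2^((2+ε)/3)` with `N = #(Irr ∩ J)` (`nblocks_law`), so
  `k(G)^ε, (dim J)^ε, |G|^ε > 2^((2+ε)/3)` (`conjClasses_law`, `finrank_law`, `card_law`) and
  NO FIXED HOST serves all small `ε` (`no_witness_of_small_eps`: none below
  `ε ≤ (2/3) log 2 / log k(G)`; `no_fixed_host`).  Sharp real form: `V ≤ ψ(dim J)`,
  `ψ(D) = D/2 + 1/8 + √((2D+1/2)³/54) ≈ 0.385 D^(3/2)` (`vol_le_psi`, via the tree's `cubic_le_real`)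
  and `D^((2+ε)/2) < N^(ε/2) ψ(D)^((2+ε)/3)` (`packing_law_sharp`): numerically `N ≳ 1.9 e^(1.27/ε)`
  comparable blocks (`≥ 6` at `ε = 1` for `D ≥ 200`, `≥ 7` for `D ≥ 2000`, `≈ 6·10^5` at
  `ε = 0.1`, `≈ 10^55` at `ε = 0.01`) and near-extremal packing against the graded Neumann cap.
* §3c PIGEONHOLE FOR PROPER `J` — `card_mul_add_card_mul_le_card`: bi-invariant `J ≠ ⊤`,
  `J`-separated, `X, Z ≠ ∅` ⇒ `|X||Y| + |Y||Z| ≤ |G|` (else `X⁻¹Y·Y⁻¹Z = G`, a separator is a delta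
  function on all of `G`, and bi-invariance forces `J = ℂ^G`): graded designs are SPARSER than
  full-budget ones; with the extremal Neumann shape `(t,2t,t)` a near-extremal proper design needs
  `dim J ≲ (3/4)|G|`, and no `(3,6,3)` proper design exists in any host of order `< 36`.
* §4 LOGICAL POSITION — `not_gradedDesignFamily_iff`: killing the crux = a graded packing barrier
  `V^(w/3) ≤ Σ_J d^w` at some FIXED `w > 2` in ALL finite groups; the barrier holds at `w = 2` (§2)
  and at `w = ω` (`gradedPackingBarrier_omega` = landed `GradedPricing_of`), so
  `2 < ω → ¬crux` and `crux → ω = 2` (`omega_eq_two_of_gradedDesignFamily`, the route's `closes`);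
  at `J = ⊤` a barrier at any `w ∈ (2, 2.41)` would contradict nothing known but would settle the
  open question "can finite groups prove `ω = 2`" negatively (BCCGU 2017 §1: "certainly not a
  foregone conclusion"; strong USP conjecture disproved BCCGNSU 2017, two-families conjecture open).
* Targets: none (no stuck stubs).  §5 `whyItResists`: briefing.

Cited from the sibling disprover of `GradedPricing` (crux 7611, `Theorems/GradedPricing/Negative/*`):
`irrChars_inter_span_single/_span_one/_bot`, `apply_one_ne_zero`, `gradedBudget_eq_card_of_comm`,
`gradedDesignFamily_no_abelian_witness`; from crux 7612: `packing_X/Z`, `cubic_le_real`.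

LANDED (cycle 1, `Theorems/GradedDesignFamily/Negative/`): `ExponentTwoEndpoint.lean` (p81664:
Peter–Weyl dimension bound, walls, `ε = 0` endpoint, closed-range crux false), `Pigeonhole.lean`
(p83239), `LoadBearing.lean` (p83628: §1); `PackingLaw.lean` / `GradedNeumannReal.lean` (§3, files
ready) queued behind the farm.
SMALL-HOST CENSUS at `ε = 1` (kit j014737 + j015049, exhaustive: blocks = class-sum eigenspaces, TPP
triples of every numerically live shape with `1 ∈ X, Y, Z`, separability by least squares over every
inclusion-maximal block set `S` with `Σ_S d³ < V`).  NO GRADED CUBE-BEATER in any searched host;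
COMPLETE (host certified empty): `S₃, D₄, Q₈, D₅, D₆, Dic₃, C₃⋊C₄, D₇`, all 9 non-abelian groups
of order 16 (1920–4960 TPP triples of live shapes `(2,4,2)…(2,7,2)` in the six groups with 8
linear characters, none `J_S`-separable below budget), `D₉, S₃×C₃` (1092 TPP triples, 0
separable), `D₁₀, Dic₅, C₅⋊C₄, C₇⋊C₃, D₁₁, S₄, D₁₂, Dic₆, C₃⋊C₈` (176 056 TPP
triples of live shapes, 0 separable), `D₁₃, D₁₄, Dic₇, C₁₃⋊C₄, C₇⋊C₆`; in the dihedral/dicyclic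
hosts `D₉…D₁₄, Dic₆, Dic₇` there is not even a TPP triple of a live shape `(3,4,3)…(4,4,4)`.
INCOMPLETE (no hit within 1500 s): `D₄×C₃` (6159 TPP triples), `Q₈×C₃` (6207), `Dic₈` (4608),
`Dic₉` (30 182), `Dic₁₀` (18 358), `D₁₅` (0 TPP triples among 6.5·10⁶ `(X,Z)` pairs), `D₁₆` (9216),
`D₁₇` (29 376).  The arithmetic filters alone (graded Neumann + walls + pigeonhole,
census_local.py) leave cells 'live' at every even order `≥ 16` (dihedral-type hosts, shapes
`(3,b,3)`, `(4,4,4)`), so emptiness of tiny hosts is a SEARCH fact, not a counting fact; a lemma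
discounting LINEAR characters in `S` does not exist (they carry one dimension each, like abelian
matrix–vector designs), cf. NOTES.
Next regimes (cycle 2+): (i) land §3 (PackingLaw, GradedNeumannReal); (ii) finish the census
(`D₁₅…D₂₁`, `Dic₆…Dic₁₀`, 27 natural hosts of order ≤ 42) with longer caps / a compiled searcher,
and the first hosts with ≥ 7 comparable blocks of degree ≥ 3 (`C₁₃ ⋊ C₃`, `(C₇×C₇) ⋊ C₃`,
`GL₂(𝔽₃)`-type); (iii) a weighted graded mixing inequality as a candidate barrier at `w = 3` for
`d_min(J) ≥ 2`; (iv) Targets once a line is picked for this crux.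
-/

noncomputable section

set_option linter.dupNamespace false

open scoped BigOperators
open Module Literature.RepresentationTheory.FiniteGroups Literature.Computability.AlgebraicComplexity
open Summit.MatrixMultiplication.MatrixMultiplication.Theses.LevelGradedCohnUmans
open Summit.MatrixMultiplication.MatrixMultiplication.Theorems

namespace Summit.MatrixMultiplication.MatrixMultiplication.Cruxes.GradedDesignFamily.Disproof

/-! ## §0 Reading of the statement -/

section Reading

variable {G : Type} [Group G]

/-- Bi-invariance of the test space `J ≤ ℂ^G`, verbatim from the crux. -/
def BiInv (J : Submodule ℂ (G → ℂ)) : Prop :=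
  ∀ f ∈ J, ∀ a b : G, (fun g : G => f (a * g * b)) ∈ J

/-- `J`-separation of `(X, Y, Z)`, verbatim from the crux (TPP at the target + BCGPU24 Def 2.1). -/
def Sep (J : Submodule ℂ (G → ℂ)) (X Y Z : Finset G) : Prop :=
  ∀ x₀ ∈ X, ∀ z₀ ∈ Z, ∃ f ∈ J, ∀ x ∈ X, ∀ y ∈ Y, ∀ y' ∈ Y, ∀ z ∈ Z,
    (x = x₀ ∧ y = y' ∧ z = z₀ → f (x⁻¹ * y * y'⁻¹ * z) = 1) ∧
    (¬ (x = x₀ ∧ y = y' ∧ z = z₀) → f (x⁻¹ * y * y'⁻¹ * z) = 0)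

/-- The GRADED BUDGET at a real exponent `s`: `Σᶠ_{χ ∈ Irr(G) ∩ J} χ(1)^s`. -/
def budget (G : Type) [Group G] (J : Submodule ℂ (G → ℂ)) (s : ℝ) : ℝ :=
  ∑ᶠ χ ∈ irrChars G ∩ (J : Set (G → ℂ)), (χ 1).re ^ s

/-- The volume `|X||Y||Z|`. -/
def vol (X Y Z : Finset G) : ℕ := X.card * Y.card * Z.card

/-- `(G, J, X, Y, Z)` is a WITNESS AT `ε`: the body of the crux's existential. -/
def Witness (ε : ℝ) (G : Type) [Group G] [Fintype G] (J : Submodule ℂ (G → ℂ))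
    (X Y Z : Finset G) : Prop :=
  BiInv J ∧ Sep J X Y Z ∧ budget G J (2 + ε) < ((vol X Y Z : ℕ) : ℝ) ^ ((2 + ε) / 3)

/-- The crux, read back through the abbreviations (definitional). -/
theorem gradedDesignFamily_iff :
    GradedDesignFamily ↔ ∀ ε : ℝ, 0 < ε → ∃ (G : Type) (_ : Group G) (_ : Fintype G)
      (J : Submodule ℂ (G → ℂ)) (X Y Z : Finset G), Witness ε G J X Y Z :=
  Iff.rfl

/-- The budget is a genuine finite sum of terms `χ(1)^s = d_χ^s ≥ 1` (no `finsum` junk). -/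
theorem budget_eq_sum [Finite G] (J : Submodule ℂ (G → ℂ)) (s : ℝ) :
    budget G J s = ∑ χ ∈ ((irrChars_finite_holds G).subset
      (Set.inter_subset_left : irrChars G ∩ (J : Set (G → ℂ)) ⊆ irrChars G)).toFinset,
        (χ 1).re ^ s :=
  finsum_mem_eq_finite_toFinset_sum _ _

/-- Each irreducible character has `χ(1) = d ≥ 1` (a natural number). -/
theorem one_le_re_apply_one {χ : G → ℂ} (h : IsIrrChar G χ) : (1 : ℝ) ≤ (χ 1).re := by
  obtain ⟨d, -, hd⟩ := h.exists_apply_one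
  have hne := GradedPricing.Negative.apply_one_ne_zero h
  rw [hd] at hne ⊢
  have : d ≠ 0 := fun h0 => hne (by simp [h0])
  simp only [Complex.natCast_re, Nat.one_le_cast]
  omega

/-- The budget is non-negative. -/
theorem budget_nonneg [Finite G] (J : Submodule ℂ (G → ℂ)) (s : ℝ) : 0 ≤ budget G J s := by
  rw [budget_eq_sum]
  refine Finset.sum_nonneg fun χ hχ => ?_
  have h := ((Set.Finite.mem_toFinset _).1 hχ).1
  exact Real.rpow_nonneg (zero_le_one.trans (one_le_re_apply_one h)) _

/-- The budget is MONOTONE in the exponent (all degrees are `≥ 1`). -/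
theorem budget_mono [Finite G] (J : Submodule ℂ (G → ℂ)) {s t : ℝ} (hst : s ≤ t) :
    budget G J s ≤ budget G J t := by
  rw [budget_eq_sum, budget_eq_sum]
  refine Finset.sum_le_sum fun χ hχ => ?_
  have h := ((Set.Finite.mem_toFinset _).1 hχ).1
  exact Real.rpow_le_rpow_of_exponent_le (one_le_re_apply_one h) hst

/-- JUNK AUDIT: a witness has `X, Y, Z` non-empty (an empty factor makes the right-hand side
`0^((2+ε)/3) = 0 ≤` budget). -/
theorem vol_pos_of_witness [Fintype G] {ε : ℝ} (hε : 0 < ε) {J : Submodule ℂ (G → ℂ)}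
    {X Y Z : Finset G} (w : Witness ε G J X Y Z) : 0 < vol X Y Z := by
  rcases Nat.eq_zero_or_pos (vol X Y Z) with h0 | hpos
  · have hlt := w.2.2
    rw [h0, Nat.cast_zero, Real.zero_rpow (by positivity)] at hlt
    exact absurd hlt (not_lt.2 (budget_nonneg J _))
  · exact hpos

end Reading

/-! ## §1 Load-bearing constraints: dropping any one makes the family TRIVIALLY realizable -/

section LoadBearing

/-- The two-element group. -/
abbrev C2 : Type := Multiplicative (ZMod 2)

/-- its generator -/
abbrev g2 : C2 := Multiplicative.ofAdd (1 : ZMod 2)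

/-- WITHOUT BI-INVARIANCE the family is trivially realizable at EVERY `ε > 0`: `G = Z/2`,
`J = ℂ·δ_g`, `X = Y = {1}`, `Z = {g}`; the only quadruple is the pattern, `δ_g` separates, and no
irreducible character lies in `ℂ·δ_g`, so the graded budget is `0 < 1 = V^((2+ε)/3)`.
Hence bi-invariance of `J` is load-bearing for the crux to mean anything. -/
theorem realizable_without_biInv (ε : ℝ) :
    ∃ (G : Type) (_ : Group G) (_ : Fintype G) (J : Submodule ℂ (G → ℂ)) (X Y Z : Finset G),
      Sep J X Y Z ∧ budget G J (2 + ε) < ((vol X Y Z : ℕ) : ℝ) ^ ((2 + ε) / 3) := by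
  refine ⟨C2, inferInstance, inferInstance,
    Submodule.span ℂ {(Pi.single g2 (1 : ℂ) : C2 → ℂ)}, {1}, {1}, {g2}, ?_, ?_⟩
  · intro x₀ hx₀ z₀ hz₀
    refine ⟨Pi.single g2 1, Submodule.subset_span rfl, ?_⟩
    intro x hx y hy y' hy' z hz
    simp only [Finset.mem_singleton] at hx hy hy' hz hx₀ hz₀
    subst hx hy hy' hz hx₀ hz₀
    exact ⟨fun _ => by simp, fun hne => absurd ⟨rfl, rfl, rfl⟩ hne⟩
  · unfold budget vol
    rw [GradedPricing.Negative.irrChars_inter_span_single GradedPricing.Negative.ofAdd_one_ne_one,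
      finsum_mem_empty]
    simp

/-- WITHOUT THE ZEROS OFF THE PATTERN (the half of separation that carries the TPP) the family is
trivially realizable at every `ε > 0`: `G = Z/2`, `J` = constants (bi-invariant, budget `1`),
`f = 1`, `X = G`, `Y = Z = {1}`, `V = 2`, and `1 < 2^((2+ε)/3)`. -/
theorem realizable_without_zeros (ε : ℝ) (hε : 0 < ε) :
    ∃ (G : Type) (_ : Group G) (_ : Fintype G) (J : Submodule ℂ (G → ℂ)) (X Y Z : Finset G),
      BiInv J ∧
      (∀ x₀ ∈ X, ∀ z₀ ∈ Z, ∃ f ∈ J, ∀ x ∈ X, ∀ y ∈ Y, ∀ y' ∈ Y, ∀ z ∈ Z,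
        (x = x₀ ∧ y = y' ∧ z = z₀ → f (x⁻¹ * y * y'⁻¹ * z) = 1)) ∧
      budget G J (2 + ε) < ((vol X Y Z : ℕ) : ℝ) ^ ((2 + ε) / 3) := by
  refine ⟨C2, inferInstance, inferInstance, Submodule.span ℂ {(1 : C2 → ℂ)},
    Finset.univ, {1}, {1}, ?_, ?_, ?_⟩
  · intro f hf a b
    obtain ⟨c, rfl⟩ := Submodule.mem_span_singleton.mp hf
    exact Submodule.mem_span_singleton.mpr ⟨c, by funext g; simp⟩
  · exact fun x₀ _ z₀ _ => ⟨1, Submodule.subset_span rfl, fun x _ y _ y' _ z _ _ => rfl⟩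
  · unfold budget vol
    rw [GradedPricing.Negative.irrChars_inter_span_one, finsum_mem_singleton]
    have h2 : (Finset.univ : Finset C2).card = 2 := by simp
    rw [h2]
    simp only [Pi.one_apply, Complex.one_re, Real.one_rpow, Finset.card_singleton, mul_one,
      Nat.cast_ofNat]
    exact Real.one_lt_rpow one_lt_two (by linarith)

/-- WITHOUT THE ONES ON THE PATTERN the family is trivially realizable at every `ε > 0`:
`J = ⊥`, `f = 0`, `X = Y = Z = {1}`: budget `0 < 1`. -/
theorem realizable_without_ones (ε : ℝ) :
    ∃ (G : Type) (_ : Group G) (_ : Fintype G) (J : Submodule ℂ (G → ℂ)) (X Y Z : Finset G),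
      BiInv J ∧
      (∀ x₀ ∈ X, ∀ z₀ ∈ Z, ∃ f ∈ J, ∀ x ∈ X, ∀ y ∈ Y, ∀ y' ∈ Y, ∀ z ∈ Z,
        (¬ (x = x₀ ∧ y = y' ∧ z = z₀) → f (x⁻¹ * y * y'⁻¹ * z) = 0)) ∧
      budget G J (2 + ε) < ((vol X Y Z : ℕ) : ℝ) ^ ((2 + ε) / 3) := by
  refine ⟨C2, inferInstance, inferInstance, ⊥, {1}, {1}, {1}, ?_, ?_, ?_⟩
  · intro f hf a b
    rw [Submodule.mem_bot] at hf ⊢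
    subst hf
    rfl
  · exact fun x₀ _ z₀ _ => ⟨0, Submodule.zero_mem _, fun x _ y _ y' _ z _ _ => rfl⟩
  · unfold budget vol
    rw [GradedPricing.Negative.irrChars_inter_bot, finsum_mem_empty]
    simp

/-- WITH `≤` FOR `<` the family is trivially realizable at every `ε`: `G = Z/2`, `J` = constants,
`X = Y = Z = {1}`: budget `1 ≤ 1`.  So the strict inequality is load-bearing (and it is exactly
what the route's Assembly consumes). -/
theorem realizable_with_le (ε : ℝ) :
    ∃ (G : Type) (_ : Group G) (_ : Fintype G) (J : Submodule ℂ (G → ℂ)) (X Y Z : Finset G),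
      BiInv J ∧ Sep J X Y Z ∧ budget G J (2 + ε) ≤ ((vol X Y Z : ℕ) : ℝ) ^ ((2 + ε) / 3) := by
  refine ⟨C2, inferInstance, inferInstance, Submodule.span ℂ {(1 : C2 → ℂ)},
    {1}, {1}, {1}, ?_, ?_, ?_⟩
  · intro f hf a b
    obtain ⟨c, rfl⟩ := Submodule.mem_span_singleton.mp hf
    exact Submodule.mem_span_singleton.mpr ⟨c, by funext g; simp⟩
  · intro x₀ hx₀ z₀ hz₀
    refine ⟨1, Submodule.subset_span rfl, ?_⟩
    intro x hx y hy y' hy' z hz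
    simp only [Finset.mem_singleton] at hx hy hy' hz hx₀ hz₀
    subst hx hy hy' hz hx₀ hz₀
    exact ⟨fun _ => rfl, fun hne => absurd ⟨rfl, rfl, rfl⟩ hne⟩
  · unfold budget vol
    rw [GradedPricing.Negative.irrChars_inter_span_one, finsum_mem_singleton]
    simp

/-- In an ABELIAN host the graded budget at any exponent is the NUMBER of characters in `J`,
hence at most the number of conjugacy classes, hence at most `|G|`. -/
theorem budget_le_card_of_comm {G : Type} [CommGroup G] [Fintype G] (J : Submodule ℂ (G → ℂ))
    (s : ℝ) : budget G J s ≤ Nat.card G := by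
  unfold budget
  rw [GradedPricing.Negative.gradedBudget_eq_card_of_comm J s]
  have h1 : (GradedPricing.Negative.irrChars_inter_finite' J).toFinset.card
      = (irrChars G ∩ (J : Set (G → ℂ))).ncard :=
    (Set.ncard_eq_toFinset_card _ (GradedPricing.Negative.irrChars_inter_finite' J)).symm
  have h2 : (irrChars G ∩ (J : Set (G → ℂ))).ncard ≤ (irrChars G).ncard :=
    Set.ncard_le_ncard Set.inter_subset_left (irrChars_finite_holds G)
  have h3 : (irrChars G).ncard ≤ Nat.card G := by
    rw [ncard_irrChars_eq_card_conjClasses]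
    exact Nat.card_le_card_of_surjective _ ConjClasses.mk_surjective
  exact_mod_cast h1.le.trans (h2.trans h3)

/-- THE WHOLE CONTENT OF THE CRUX IS `ε ≤ 1`: for every `ε > 1` the family is realized by the
trivial matrix–vector design `X = G = Z/2`, `Y = Z = {1}`, `J = ℂ^G` (budget `2 = |G|`,
volume `2`, and `2 < 2^((2+ε)/3)` iff `ε > 1`). -/
theorem witnessC2_of_one_lt {ε : ℝ} (hε : 1 < ε) :
    Witness ε C2 ⊤ Finset.univ {1} {1} := by
  refine ⟨?_, ?_, ?_⟩
  · intro f _ a b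
    exact Submodule.mem_top
  · intro x₀ hx₀ z₀ hz₀
    refine ⟨Pi.single x₀⁻¹ 1, Submodule.mem_top, ?_⟩
    intro x hx y hy y' hy' z hz
    simp only [Finset.mem_singleton] at hy hy' hz hz₀
    subst hy hy' hz hz₀
    refine ⟨?_, ?_⟩
    · rintro ⟨rfl, -, -⟩
      simp
    · intro hne
      have hx' : x ≠ x₀ := fun h => hne ⟨h, rfl, rfl⟩
      have : x⁻¹ ≠ x₀⁻¹ := fun h => hx' (inv_injective h)
      simp [this]
  · have hb : budget C2 ⊤ (2 + ε) ≤ 2 := by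
      have := budget_le_card_of_comm (G := C2) ⊤ (2 + ε)
      simpa using this
    unfold vol
    have h2 : (Finset.univ : Finset C2).card = 2 := by simp
    rw [h2]
    simp only [Finset.card_singleton, mul_one, Nat.cast_ofNat]
    calc budget C2 ⊤ (2 + ε) ≤ 2 := hb
      _ = (2 : ℝ) ^ (1 : ℝ) := (Real.rpow_one 2).symm
      _ < (2 : ℝ) ^ ((2 + ε) / 3) := Real.rpow_lt_rpow_of_exponent_lt one_lt_two (by linarith)

/-- For every `ε > 1` the family is realized (by the trivial `Z/2` matrix–vector design). -/
theorem witness_of_one_lt {ε : ℝ} (hε : 1 < ε) :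
    ∃ (G : Type) (_ : Group G) (_ : Fintype G) (J : Submodule ℂ (G → ℂ)) (X Y Z : Finset G),
      Witness ε G J X Y Z :=
  ⟨C2, inferInstance, inferInstance, ⊤, _, _, _, witnessC2_of_one_lt hε⟩

/-- … and for `0 < ε ≤ 1` NO ABELIAN HOST CARRIES A WITNESS (the sibling disprover's
`gradedDesignFamily_no_abelian_witness`, crux 7611: `V ≤ dim J ≤ #(Irr ∩ J)` = budget).  Together:
**abelian hosts realize the family at `ε` iff `ε > 1`** — the crux lives entirely in the range
`0 < ε ≤ 1` and needs non-abelian hosts there. -/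
theorem exists_abelian_witness_iff {ε : ℝ} (hε : 0 < ε) :
    (∃ (G : Type) (_ : CommGroup G) (_ : Fintype G) (J : Submodule ℂ (G → ℂ)) (X Y Z : Finset G),
      Witness ε G J X Y Z) ↔ 1 < ε := by
  constructor
  · rintro ⟨G, _, _, J, X, Y, Z, hJ, hsep, hlt⟩
    by_contra hle
    push Not at hle
    exact GradedPricing.Negative.gradedDesignFamily_no_abelian_witness hε hle J hJ X Y Z hsep hlt
  · intro h1
    exact ⟨C2, inferInstance, inferInstance, ⊤, _, _, _, witnessC2_of_one_lt h1⟩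

end LoadBearing

/-! ## §2 Walls, Peter–Weyl, and the exponent-2 endpoint (every group) -/

section Walls

variable {G : Type} [Group G] [Fintype G]

/-- WALLS (graded Neumann count of the sibling crux 7612, `packing_X` / `packing_Z`): for a
bi-invariant `J` and a `J`-separated triple, `V² ≤ (dim J)³`. -/
theorem vol_sq_le_finrank_cube (J : Submodule ℂ (G → ℂ)) (hJ : BiInv J)
    (X Y Z : Finset G) (h : Sep J X Y Z) :
    (vol X Y Z) ^ 2 ≤ (finrank ℂ J) ^ 3 := by
  classical
  unfold vol
  rcases X.eq_empty_or_nonempty with rfl | ⟨x₁, hx₁⟩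
  · simp
  rcases Y.eq_empty_or_nonempty with rfl | ⟨y₁, hy₁⟩
  · simp
  rcases Z.eq_empty_or_nonempty with rfl | ⟨z₁, hz₁⟩
  · simp
  have hr : ∀ f ∈ J, ∀ t : G, (fun g => f (g * t)) ∈ J := fun f hf t => by
    simpa only [one_mul] using hJ f hf 1 t
  have hl : ∀ f ∈ J, ∀ t : G, (fun g => f (t * g)) ∈ J := fun f hf t => by
    simpa only [mul_one] using hJ f hf t 1
  have N1 := LevelTwoBeatsCubes.Negative.packing_X J hr X Y Z h hy₁ hz₁
  have N2 := LevelTwoBeatsCubes.Negative.packing_Z J hl X Y Z h hx₁ hy₁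
  have ha : 1 ≤ X.card := Finset.card_pos.mpr ⟨x₁, hx₁⟩
  have hc : 1 ≤ Z.card := Finset.card_pos.mpr ⟨z₁, hz₁⟩
  obtain ⟨b, hbY⟩ : ∃ b, Y.card = b + 1 := ⟨Y.card - 1, by
    have := Finset.card_pos.mpr ⟨y₁, hy₁⟩; omega⟩
  rw [hbY] at N1 N2 ⊢
  simp only [Nat.add_sub_cancel] at N1 N2
  set a := X.card
  set c := Z.card
  set D := finrank ℂ J
  have hab : a * (b + 1) ≤ D :=
    calc a * (b + 1) = a * b + a * 1 := by ring
      _ ≤ a * b + a * c := Nat.add_le_add_left (Nat.mul_le_mul_left a hc) _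
      _ = a * c + a * b := Nat.add_comm _ _
      _ ≤ D := N1
  have hac : a * c ≤ D := le_trans (Nat.le_add_right _ _) N1
  have hbc : (b + 1) * c ≤ D :=
    calc (b + 1) * c = 1 * c + b * c := by ring
      _ ≤ a * c + b * c := Nat.add_le_add_right (Nat.mul_le_mul_right c ha) _
      _ ≤ D := N2
  calc (a * (b + 1) * c) ^ 2 = (a * (b + 1)) * ((b + 1) * c) * (a * c) := by ring
    _ ≤ D * D * D := Nat.mul_le_mul (Nat.mul_le_mul hab hbc) hac
    _ = D ^ 3 := by ring

/-- `V^(2/3) ≤ dim J`. -/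
theorem rpow_vol_le_finrank (J : Submodule ℂ (G → ℂ)) (hJ : BiInv J)
    (X Y Z : Finset G) (h : Sep J X Y Z) :
    ((vol X Y Z : ℕ) : ℝ) ^ ((2 : ℝ) / 3) ≤ (finrank ℂ J : ℝ) := by
  have hsq := vol_sq_le_finrank_cube J hJ X Y Z h
  have hsqR : ((vol X Y Z : ℕ) : ℝ) ^ (2 : ℝ) ≤ ((finrank ℂ J : ℕ) : ℝ) ^ (3 : ℝ) := by
    rw [show (2 : ℝ) = ((2 : ℕ) : ℝ) by norm_num, show (3 : ℝ) = ((3 : ℕ) : ℝ) by norm_num,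
      Real.rpow_natCast, Real.rpow_natCast]
    exact_mod_cast hsq
  have hV0 : (0 : ℝ) ≤ ((vol X Y Z : ℕ) : ℝ) := Nat.cast_nonneg _
  have hD0 : (0 : ℝ) ≤ ((finrank ℂ J : ℕ) : ℝ) := Nat.cast_nonneg _
  calc ((vol X Y Z : ℕ) : ℝ) ^ ((2 : ℝ) / 3)
      = ((((vol X Y Z : ℕ) : ℝ)) ^ (2 : ℝ)) ^ ((1 : ℝ) / 3) := by
        rw [← Real.rpow_mul hV0]; norm_num
    _ ≤ (((finrank ℂ J : ℕ) : ℝ) ^ (3 : ℝ)) ^ ((1 : ℝ) / 3) :=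
        Real.rpow_le_rpow (Real.rpow_nonneg hV0 _) hsqR (by norm_num)
    _ = ((finrank ℂ J : ℕ) : ℝ) := by
        rw [← Real.rpow_mul hD0]; norm_num

open scoped Classical in
/-- PETER–WEYL CONTAINMENT, DIMENSION FORM: a bi-invariant `J` lies in the span of the matrix
coefficients of the Wedderburn blocks whose characters it contains (`le_repFun_charSupport`, the
transfer step of the PROVED sibling crux `GradedPricing`), so `dim J ≤ Σ_{χ ∈ Irr(G) ∩ J} χ(1)²`,
i.e. `dim J ≤ budget at exponent 2`. -/
theorem finrank_le_budget_two (J : Submodule ℂ (G → ℂ)) (hJ : BiInv J) :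
    (finrank ℂ J : ℝ) ≤ budget G J 2 := by
  obtain ⟨r, d, hd, ⟨φ⟩⟩ := exists_algEquiv_pi_matrix G
  haveI := hd
  -- the family of blocks visible in `J`
  let ι := {i : Fin r // (blockRep φ i).character ∈ J}
  let n : ι → ℕ := fun i => d i.1
  let ρ : ∀ i : ι, G →* Matrix.GeneralLinearGroup (Fin (n i)) ℂ := fun i =>
    ((((Pi.evalAlgHom ℂ (fun j : Fin r => Matrix (Fin (d j)) (Fin (d j)) ℂ) i.1).comp
      φ.toAlgHom).toMonoidHom).comp (MonoidAlgebra.of ℂ G)).toHomUnits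
  have hle : J ≤ repFun n ρ := GradedPricing.le_repFun_charSupport φ J hJ
  -- `repFun n ρ` is the span of the range of the matrix-coefficient map on `Σ i, Fin (n i) × Fin (n i)`
  let F : (Σ i : ι, Fin (n i) × Fin (n i)) → (G → ℂ) := fun k g =>
    ((ρ k.1 g : Matrix.GeneralLinearGroup (Fin (n k.1)) ℂ) : Matrix (Fin (n k.1)) (Fin (n k.1)) ℂ)
      k.2.1 k.2.2
  have hspan : repFun n ρ = Submodule.span ℂ (Set.range F) := by
    unfold repFun
    congr 1
    ext ψ
    simp only [Set.mem_setOf_eq, Set.mem_range]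
    constructor
    · rintro ⟨i, a, b, rfl⟩
      exact ⟨⟨i, (a, b)⟩, rfl⟩
    · rintro ⟨⟨i, a, b⟩, rfl⟩
      exact ⟨i, a, b, rfl⟩
  have h1 : finrank ℂ J ≤ finrank ℂ (repFun n ρ) := Submodule.finrank_mono hle
  have h2 : finrank ℂ (repFun n ρ) ≤ Fintype.card (Σ i : ι, Fin (n i) × Fin (n i)) := by
    rw [hspan]
    exact finrank_range_le_card F
  have h3 : Fintype.card (Σ i : ι, Fin (n i) × Fin (n i)) = ∑ i : ι, (d i.1) ^ 2 := by
    rw [Fintype.card_sigma]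
    refine Finset.sum_congr rfl fun i _ => ?_
    rw [Fintype.card_prod, Fintype.card_fin, sq]
  have h4 : ((∑ i : ι, (d i.1) ^ 2 : ℕ) : ℝ) = ∑ i : ι, ((d i.1 : ℕ) : ℝ) ^ (2 : ℝ) := by
    push_cast
    refine Finset.sum_congr rfl fun i _ => ?_
    rw [Real.rpow_two]
  have h5 := GradedPricing.sum_charSupport_rpow_le φ J 2
  calc (finrank ℂ J : ℝ) ≤ ((∑ i : ι, (d i.1) ^ 2 : ℕ) : ℝ) := by
        exact_mod_cast h1.trans (h3 ▸ h2)
    _ = ∑ i : ι, ((d i.1 : ℕ) : ℝ) ^ (2 : ℝ) := h4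
    _ ≤ budget G J 2 := h5

/-- THE EXPONENT-2 ENDPOINT: for EVERY finite group, bi-invariant `J` and `J`-separated triple,
`V^(2/3) ≤ budget at exponent 2` — the crux's inequality with `2 + ε` replaced by `2` is never
strict in the right direction. -/
theorem rpow_vol_le_budget_two (J : Submodule ℂ (G → ℂ)) (hJ : BiInv J)
    (X Y Z : Finset G) (h : Sep J X Y Z) :
    ((vol X Y Z : ℕ) : ℝ) ^ ((2 : ℝ) / 3) ≤ budget G J 2 :=
  (rpow_vol_le_finrank J hJ X Y Z h).trans (finrank_le_budget_two J hJ)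

/-- Hence NO WITNESS AT `ε = 0` exists in any group: the open condition `0 < ε` of the crux is
exactly right (the closed version `0 ≤ ε` of the crux is FALSE, `not_gradedDesignFamily_closed`). -/
theorem not_witness_zero (J : Submodule ℂ (G → ℂ)) (X Y Z : Finset G) :
    ¬ Witness 0 G J X Y Z := by
  rintro ⟨hJ, hsep, hlt⟩
  rw [add_zero] at hlt
  exact absurd (hlt.trans_le (rpow_vol_le_budget_two J hJ X Y Z hsep)) (lt_irrefl _)

/-- The crux with `0 ≤ ε` in place of `0 < ε` is FALSE. -/
theorem not_gradedDesignFamily_closed :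
    ¬ ∀ ε : ℝ, 0 ≤ ε → ∃ (G : Type) (_ : Group G) (_ : Fintype G)
      (J : Submodule ℂ (G → ℂ)) (X Y Z : Finset G), Witness ε G J X Y Z := by
  intro h
  obtain ⟨G, _, _, J, X, Y, Z, w⟩ := h 0 le_rfl
  exact not_witness_zero J X Y Z w

end Walls

/-! ## §3 The graded packing law: how many blocks and how large a host a witness needs -/

section PackingLaw

variable {G : Type} [Group G] [Fintype G]

/-- The number of irreducible characters VISIBLE in `J` (= number of isotypic blocks of `J` when
`J` is bi-invariant). -/
def nblocks (G : Type) [Group G] (J : Submodule ℂ (G → ℂ)) : ℕ :=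
  (irrChars G ∩ (J : Set (G → ℂ))).ncard

theorem nblocks_eq_card (J : Submodule ℂ (G → ℂ)) :
    nblocks G J = ((irrChars_finite_holds G).subset
      (Set.inter_subset_left : irrChars G ∩ (J : Set (G → ℂ)) ⊆ irrChars G)).toFinset.card :=
  Set.ncard_eq_toFinset_card _ _

/-- `#(Irr ∩ J) ≤ #` conjugacy classes of the host. -/
theorem nblocks_le_card_conjClasses (J : Submodule ℂ (G → ℂ)) :
    nblocks G J ≤ Nat.card (ConjClasses G) := by
  unfold nblocks
  rw [← ncard_irrChars_eq_card_conjClasses]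
  exact Set.ncard_le_ncard Set.inter_subset_left (irrChars_finite_holds G)

/-- `#(Irr ∩ J) ≤ dim J` (irreducible characters are linearly independent). -/
theorem nblocks_le_finrank (J : Submodule ℂ (G → ℂ)) : nblocks G J ≤ finrank ℂ J := by
  classical
  have hfin : (irrChars G ∩ (J : Set (G → ℂ))).Finite :=
    (irrChars_finite_holds G).subset Set.inter_subset_left
  rw [nblocks, Set.ncard_eq_toFinset_card _ hfin]
  have hmem : ∀ χ ∈ hfin.toFinset, χ ∈ irrChars G ∩ (J : Set (G → ℂ)) :=
    fun χ hχ => hfin.mem_toFinset.1 hχ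
  let v : hfin.toFinset → J := fun χ => ⟨χ.1, (hmem χ.1 χ.2).2⟩
  have h1 : LinearIndependent ℂ (J.subtype ∘ v) := by
    let e : hfin.toFinset → irrChars G := fun χ => ⟨χ.1, (hmem χ.1 χ.2).1⟩
    have he : Function.Injective e := fun a b h =>
      Subtype.ext (by simpa [e] using congrArg Subtype.val h)
    exact (linearIndependent_irrChars (G := G)).comp e he
  have hli : LinearIndependent ℂ v := LinearIndependent.of_comp J.subtype h1
  simpa using hli.fintype_card_le_finrank

/-- POWER MEAN (Jensen): `budget₂^((2+ε)/2) ≤ N^(ε/2) · budget_(2+ε)`, `N = #(Irr ∩ J)`. -/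
theorem budget_two_rpow_le (J : Submodule ℂ (G → ℂ)) {ε : ℝ} (hε : 0 ≤ ε) :
    budget G J 2 ^ ((2 + ε) / 2) ≤ (nblocks G J : ℝ) ^ (ε / 2) * budget G J (2 + ε) := by
  rw [budget_eq_sum, budget_eq_sum, nblocks_eq_card]
  set S := ((irrChars_finite_holds G).subset
      (Set.inter_subset_left : irrChars G ∩ (J : Set (G → ℂ)) ⊆ irrChars G)).toFinset
  have hq : 1 ≤ (2 + ε) / 2 := by linarith
  have hnn : ∀ χ ∈ S, 0 ≤ (χ 1).re ^ (2 : ℝ) := fun χ hχ =>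
    Real.rpow_nonneg (zero_le_one.trans
      (one_le_re_apply_one ((Set.Finite.mem_toFinset _).1 hχ).1)) _
  have key := Real.rpow_sum_le_const_mul_sum_rpow_of_nonneg S hq hnn
  have hexp : (2 + ε) / 2 - 1 = ε / 2 := by ring
  rw [hexp] at key
  refine key.trans (le_of_eq ?_)
  congr 1
  refine Finset.sum_congr rfl fun χ hχ => ?_
  have h0 : 0 ≤ (χ 1).re :=
    zero_le_one.trans (one_le_re_apply_one ((Set.Finite.mem_toFinset _).1 hχ).1)
  rw [← Real.rpow_mul h0]
  congr 1
  ring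

/-- A witness has `dim J ≥ 1` … -/
theorem finrank_pos_of_witness {ε : ℝ} (hε : 0 < ε) {J : Submodule ℂ (G → ℂ)}
    {X Y Z : Finset G} (w : Witness ε G J X Y Z) : 0 < finrank ℂ J := by
  have hV := vol_pos_of_witness hε w
  have hsq := vol_sq_le_finrank_cube J w.1 X Y Z w.2.1
  by_contra h0
  push Not at h0
  have : finrank ℂ J = 0 := by omega
  rw [this] at hsq
  have : 0 < vol X Y Z ^ 2 := by positivity
  omega

/-- … indeed `dim J ≥ 2`: if `dim J = 1` then `V = 1 ≤ budget`. -/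
theorem two_le_finrank_of_witness {ε : ℝ} (hε : 0 < ε) {J : Submodule ℂ (G → ℂ)}
    {X Y Z : Finset G} (w : Witness ε G J X Y Z) : 2 ≤ finrank ℂ J := by
  have hD := finrank_pos_of_witness hε w
  have hV := vol_pos_of_witness hε w
  have hsq := vol_sq_le_finrank_cube J w.1 X Y Z w.2.1
  by_contra h2
  push Not at h2
  have hD1 : finrank ℂ J = 1 := by omega
  rw [hD1] at hsq
  have hV1 : vol X Y Z = 1 := by nlinarith
  have hlt := w.2.2
  rw [hV1, Nat.cast_one, Real.one_rpow] at hlt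
  have hb : (1 : ℝ) ≤ budget G J (2 + ε) := by
    calc (1 : ℝ) = (finrank ℂ J : ℝ) := by rw [hD1, Nat.cast_one]
      _ ≤ budget G J 2 := finrank_le_budget_two J w.1
      _ ≤ budget G J (2 + ε) := budget_mono J (by linarith)
  linarith

/-- Arithmetic core of the sharper wall: `2 (p m + p²)² ≤ (p² + m)³` unless `p ≤ 1 ∧ m = 0`
(`p⁴(p²-2) + p³m(3p-4) + p²m² + m³ ≥ 0` for `p ≥ 2`; `(m-1)(m+1)² ≥ 0` for `p = 1`). -/
theorem two_mul_sq_le_cube (p m : ℕ) (h : 2 ≤ p ∨ 1 ≤ m) :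
    2 * (p * m + p ^ 2) ^ 2 ≤ (p ^ 2 + m) ^ 3 := by
  rcases Nat.lt_or_ge p 2 with hp | hp
  · interval_cases p
    · ring_nf
      nlinarith [Nat.zero_le (m ^ 3)]
    · have hm : 1 ≤ m := by omega
      obtain ⟨k, rfl⟩ : ∃ k, m = k + 1 := ⟨m - 1, by omega⟩
      ring_nf
      nlinarith [Nat.zero_le k, Nat.zero_le (k ^ 2), Nat.zero_le (k ^ 3)]
  · have h1 : 2 * p ^ 4 ≤ p ^ 6 := by
      have : 2 ≤ p ^ 2 := by nlinarith
      calc 2 * p ^ 4 ≤ p ^ 2 * p ^ 4 := Nat.mul_le_mul_right _ this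
        _ = p ^ 6 := by ring
    have h2 : 4 * p ^ 3 * m ≤ 3 * p ^ 4 * m := by
      have h4 : 4 * p ^ 3 ≤ 3 * p ^ 4 := by
        have : 4 ≤ 3 * p := by omega
        calc 4 * p ^ 3 ≤ 3 * p * p ^ 3 := Nat.mul_le_mul_right _ this
          _ = 3 * p ^ 4 := by ring
      exact Nat.mul_le_mul_right m h4
    nlinarith [h1, h2, Nat.zero_le (p ^ 2 * m ^ 2), Nat.zero_le (m ^ 3)]

/-- Core counting step of the sharper wall: `1 ≤ p ≤ q`, the slab count `pq + qb ≤ D` of the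
larger side and `D ≥ 2` give `2 (p (b+1) q)² ≤ D³` (via `V ≤ pD + p² - p³ = pm + p²`,
`D = p² + m`). -/
theorem two_mul_sq_vol_le (p q b D : ℕ) (hp : 1 ≤ p) (hpq : p ≤ q) (hN : p * q + q * b ≤ D)
    (hD : 2 ≤ D) : 2 * (p * (b + 1) * q) ^ 2 ≤ D ^ 3 := by
  have hp2 : p ^ 2 ≤ D := by nlinarith
  obtain ⟨m, rfl⟩ : ∃ m, D = p ^ 2 + m := ⟨D - p ^ 2, by omega⟩
  have key : p * (p * q + q * b) ≤ p * (p ^ 2 + m) := Nat.mul_le_mul_left _ hN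
  have hV : p * (b + 1) * q ≤ p * m + p ^ 2 := by
    zify at key hp hpq ⊢
    have hint : (0 : ℤ) ≤ (p : ℤ) * ((p : ℤ) - 1) * ((q : ℤ) - (p : ℤ)) :=
      mul_nonneg (mul_nonneg (by linarith) (by linarith)) (by linarith)
    nlinarith [key, hint]
  have hpm : 2 ≤ p ∨ 1 ≤ m := by
    rcases Nat.lt_or_ge p 2 with h | h
    · right
      have : p = 1 := by omega
      subst this
      omega
    · exact Or.inl h
  calc 2 * (p * (b + 1) * q) ^ 2 ≤ 2 * (p * m + p ^ 2) ^ 2 :=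
        Nat.mul_le_mul_left 2 (Nat.pow_le_pow_left hV 2)
    _ ≤ (p ^ 2 + m) ^ 3 := two_mul_sq_le_cube p m hpm

/-- SHARPER WALL (graded Neumann count + cubic arithmetic): for a bi-invariant `J` with
`dim J ≥ 2` and a `J`-separated triple, `2 V² ≤ (dim J)³`, i.e. `V ≤ (dim J)^(3/2)/√2`.
(The constant `1/√2` is attained numerically at `dim J = 2`, `V = 2`; asymptotically the graded
Neumann cap is `√(4/27)·D^(3/2) ≈ 0.385 D^(3/2)`, see `vol_le_psi`.) -/
theorem two_mul_vol_sq_le_finrank_cube (J : Submodule ℂ (G → ℂ)) (hJ : BiInv J)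
    (X Y Z : Finset G) (h : Sep J X Y Z) (hD : 2 ≤ finrank ℂ J) :
    2 * (vol X Y Z) ^ 2 ≤ (finrank ℂ J) ^ 3 := by
  classical
  unfold vol
  rcases X.eq_empty_or_nonempty with rfl | ⟨x₁, hx₁⟩
  · simp
  rcases Y.eq_empty_or_nonempty with rfl | ⟨y₁, hy₁⟩
  · simp
  rcases Z.eq_empty_or_nonempty with rfl | ⟨z₁, hz₁⟩
  · simp
  have hr : ∀ f ∈ J, ∀ t : G, (fun g => f (g * t)) ∈ J := fun f hf t => by
    simpa only [one_mul] using hJ f hf 1 t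
  have hl : ∀ f ∈ J, ∀ t : G, (fun g => f (t * g)) ∈ J := fun f hf t => by
    simpa only [mul_one] using hJ f hf t 1
  have N1 := LevelTwoBeatsCubes.Negative.packing_X J hr X Y Z h hy₁ hz₁
  have N2 := LevelTwoBeatsCubes.Negative.packing_Z J hl X Y Z h hx₁ hy₁
  have ha : 1 ≤ X.card := Finset.card_pos.mpr ⟨x₁, hx₁⟩
  have hc : 1 ≤ Z.card := Finset.card_pos.mpr ⟨z₁, hz₁⟩
  obtain ⟨b, hbY⟩ : ∃ b, Y.card = b + 1 := ⟨Y.card - 1, by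
    have := Finset.card_pos.mpr ⟨y₁, hy₁⟩; omega⟩
  rw [hbY] at N1 N2 ⊢
  simp only [Nat.add_sub_cancel] at N1 N2
  set a := X.card
  set c := Z.card
  set D := finrank ℂ J
  rcases le_total c a with hca | hac
  · -- `p = c ≤ a = q`, slab count `N1 : a c + a b ≤ D`
    have hN : c * a + a * b ≤ D := by simpa only [mul_comm c a] using N1
    have := two_mul_sq_vol_le c a b D hc hca hN hD
    calc 2 * (a * (b + 1) * c) ^ 2 = 2 * (c * (b + 1) * a) ^ 2 := by ring
      _ ≤ D ^ 3 := this
  · -- `p = a ≤ c = q`, slab count `N2 : a c + b c ≤ D`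
    have hN : a * c + c * b ≤ D := by simpa only [mul_comm c b] using N2
    exact two_mul_sq_vol_le a c b D ha hac hN hD

/-- THE PACKING LAW (clean form).  Any witness at `ε > 0` — in any finite group — satisfies
`N^ε > 2^((2+ε)/3)`, where `N = #(Irr(G) ∩ J)` is the number of irreducible characters the tests
see.  Chain: `D^((2+ε)/2) ≤ budget₂^((2+ε)/2)` (Peter–Weyl) `≤ N^(ε/2)·budget_(2+ε)` (power mean)
`< N^(ε/2)·V^((2+ε)/3)` (witness) `≤ N^(ε/2)·(D³/2)^((2+ε)/6)` (sharper wall). -/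
theorem nblocks_law {ε : ℝ} (hε : 0 < ε) {J : Submodule ℂ (G → ℂ)} {X Y Z : Finset G}
    (w : Witness ε G J X Y Z) : (2 : ℝ) ^ ((2 + ε) / 3) < (nblocks G J : ℝ) ^ ε := by
  have hD2 := two_le_finrank_of_witness hε w
  set D := finrank ℂ J with hDdef
  have hDpos : (0 : ℝ) < D := by exact_mod_cast (show 0 < D by omega)
  have hDa : (0 : ℝ) < (D : ℝ) ^ ((2 + ε) / 2) := Real.rpow_pos_of_pos hDpos _
  -- (1) `D^((2+ε)/2) ≤ N^(ε/2) · budget_(2+ε)`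
  have h1 : (D : ℝ) ^ ((2 + ε) / 2) ≤ (nblocks G J : ℝ) ^ (ε / 2) * budget G J (2 + ε) :=
    (Real.rpow_le_rpow hDpos.le (finrank_le_budget_two J w.1) (by positivity)).trans
      (budget_two_rpow_le J hε.le)
  -- (2) `V^((2+ε)/3) ≤ D^((2+ε)/2) / 2^((2+ε)/6)`
  have hV2 := two_mul_vol_sq_le_finrank_cube J w.1 X Y Z w.2.1 hD2
  have h0V : (0 : ℝ) ≤ ((vol X Y Z : ℕ) : ℝ) := Nat.cast_nonneg _
  have hsq : ((vol X Y Z : ℕ) : ℝ) ^ (2 : ℕ) ≤ (D : ℝ) ^ (3 : ℕ) / 2 := by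
    have h' : ((2 * (vol X Y Z) ^ 2 : ℕ) : ℝ) ≤ ((D ^ 3 : ℕ) : ℝ) := by exact_mod_cast hV2
    push_cast at h'
    linarith
  have hVR : ((vol X Y Z : ℕ) : ℝ) ≤ ((D : ℝ) ^ (3 : ℕ) / 2) ^ ((1 : ℝ) / 2) := by
    calc ((vol X Y Z : ℕ) : ℝ) = ((((vol X Y Z : ℕ) : ℝ)) ^ (2 : ℕ)) ^ ((1 : ℝ) / 2) := by
          rw [← Real.sqrt_eq_rpow, Real.sqrt_sq h0V]
      _ ≤ ((D : ℝ) ^ (3 : ℕ) / 2) ^ ((1 : ℝ) / 2) :=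
          Real.rpow_le_rpow (by positivity) hsq (by norm_num)
  have h2 : ((vol X Y Z : ℕ) : ℝ) ^ ((2 + ε) / 3)
      ≤ (D : ℝ) ^ ((2 + ε) / 2) / (2 : ℝ) ^ ((2 + ε) / 6) := by
    calc ((vol X Y Z : ℕ) : ℝ) ^ ((2 + ε) / 3)
        ≤ (((D : ℝ) ^ (3 : ℕ) / 2) ^ ((1 : ℝ) / 2)) ^ ((2 + ε) / 3) :=
          Real.rpow_le_rpow h0V hVR (by positivity)
      _ = ((D : ℝ) ^ (3 : ℕ) / 2) ^ ((2 + ε) / 6) := by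
          rw [← Real.rpow_mul (by positivity)]
          ring_nf
      _ = ((D : ℝ) ^ (3 : ℕ)) ^ ((2 + ε) / 6) / (2 : ℝ) ^ ((2 + ε) / 6) := by
          rw [Real.div_rpow (by positivity) (by norm_num)]
      _ = (D : ℝ) ^ ((2 + ε) / 2) / (2 : ℝ) ^ ((2 + ε) / 6) := by
          congr 1
          rw [show ((D : ℝ) ^ (3 : ℕ)) = (D : ℝ) ^ (3 : ℝ) by norm_cast,
            ← Real.rpow_mul hDpos.le]
          ring_nf
  have hlt : budget G J (2 + ε) < ((vol X Y Z : ℕ) : ℝ) ^ ((2 + ε) / 3) := w.2.2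
  -- `N^(ε/2) > 0` (else the right-hand side of (1) vanishes)
  have hNpos : (0 : ℝ) < (nblocks G J : ℝ) ^ (ε / 2) := by
    by_contra hle
    push Not at hle
    have h0 : (nblocks G J : ℝ) ^ (ε / 2) = 0 :=
      le_antisymm hle (Real.rpow_nonneg (Nat.cast_nonneg _) _)
    rw [h0, zero_mul] at h1
    linarith
  have h3 : (D : ℝ) ^ ((2 + ε) / 2)
      < (nblocks G J : ℝ) ^ (ε / 2) * ((D : ℝ) ^ ((2 + ε) / 2) / (2 : ℝ) ^ ((2 + ε) / 6)) :=
    h1.trans_lt ((mul_lt_mul_of_pos_left hlt hNpos).trans_le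
      (mul_le_mul_of_nonneg_left h2 hNpos.le))
  have h2pos : (0 : ℝ) < (2 : ℝ) ^ ((2 + ε) / 6) := Real.rpow_pos_of_pos two_pos _
  have h4 : (2 : ℝ) ^ ((2 + ε) / 6) < (nblocks G J : ℝ) ^ (ε / 2) := by
    rw [mul_div_assoc', lt_div_iff₀ h2pos] at h3
    nlinarith
  have h0N : (0 : ℝ) ≤ (nblocks G J : ℝ) := Nat.cast_nonneg _
  calc (2 : ℝ) ^ ((2 + ε) / 3) = ((2 : ℝ) ^ ((2 + ε) / 6)) ^ (2 : ℝ) := by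
        rw [← Real.rpow_mul (by norm_num)]
        ring_nf
    _ < ((nblocks G J : ℝ) ^ (ε / 2)) ^ (2 : ℝ) := Real.rpow_lt_rpow h2pos.le h4 two_pos
    _ = (nblocks G J : ℝ) ^ ε := by
        rw [← Real.rpow_mul h0N]
        ring_nf

/-- NO SINGLE-BLOCK DESIGN: every witness (any `ε > 0`, any group) sees at least TWO irreducible
characters — a single isotypic block `M_d` (`dim = d²`, budget `d^(2+ε)`) never carries volume
`> d³`. -/
theorem two_le_nblocks {ε : ℝ} (hε : 0 < ε) {J : Submodule ℂ (G → ℂ)} {X Y Z : Finset G}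
    (w : Witness ε G J X Y Z) : 2 ≤ nblocks G J := by
  have h := nblocks_law hε w
  have h1 : (1 : ℝ) < (2 : ℝ) ^ ((2 + ε) / 3) := Real.one_lt_rpow one_lt_two (by positivity)
  by_contra hlt
  push Not at hlt
  have h2 : (nblocks G J : ℝ) ^ ε ≤ 1 := by
    rcases Nat.lt_or_ge (nblocks G J) 1 with h0 | h0
    · have : nblocks G J = 0 := by omega
      rw [this, Nat.cast_zero, Real.zero_rpow hε.ne']
      norm_num
    · have : nblocks G J = 1 := by omega
      rw [this, Nat.cast_one, Real.one_rpow]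
  linarith

/-- HOST FORM OF THE LAW: `k(G)^ε > 2^((2+ε)/3)`, `k(G)` = number of conjugacy classes. -/
theorem conjClasses_law {ε : ℝ} (hε : 0 < ε) {J : Submodule ℂ (G → ℂ)} {X Y Z : Finset G}
    (w : Witness ε G J X Y Z) :
    (2 : ℝ) ^ ((2 + ε) / 3) < (Nat.card (ConjClasses G) : ℝ) ^ ε :=
  (nblocks_law hε w).trans_le (Real.rpow_le_rpow (Nat.cast_nonneg _)
    (Nat.cast_le.2 (nblocks_le_card_conjClasses J)) hε.le)

/-- DIMENSION FORM OF THE LAW: `(dim J)^ε > 2^((2+ε)/3)`. -/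
theorem finrank_law {ε : ℝ} (hε : 0 < ε) {J : Submodule ℂ (G → ℂ)} {X Y Z : Finset G}
    (w : Witness ε G J X Y Z) :
    (2 : ℝ) ^ ((2 + ε) / 3) < (finrank ℂ J : ℝ) ^ ε :=
  (nblocks_law hε w).trans_le (Real.rpow_le_rpow (Nat.cast_nonneg _)
    (Nat.cast_le.2 (nblocks_le_finrank J)) hε.le)

/-- ORDER FORM OF THE LAW: `|G|^ε > 2^((2+ε)/3)`; e.g. a witness at `ε = 1/100` needs
`|G| > 2^67 > 10^20` (the sharp constant, `(27/4)^((2+ε)/(3ε))`, gives `> 10^55`; docblock). -/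
theorem card_law {ε : ℝ} (hε : 0 < ε) {J : Submodule ℂ (G → ℂ)} {X Y Z : Finset G}
    (w : Witness ε G J X Y Z) :
    (2 : ℝ) ^ ((2 + ε) / 3) < (Nat.card G : ℝ) ^ ε :=
  (conjClasses_law hε w).trans_le (Real.rpow_le_rpow (Nat.cast_nonneg _)
    (Nat.cast_le.2 (Nat.card_le_card_of_surjective _ ConjClasses.mk_surjective)) hε.le)

/-- NO FIXED HOST: a finite group `G` witnesses NO exponent `ε ≤ (2/3)·log 2 / log k(G)`
(`k(G)` = number of conjugacy classes); in particular every witness family for the crux must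
let `|G| → ∞` (indeed `log |G| ≳ 1/ε`) as `ε → 0`. -/
theorem no_witness_of_small_eps {ε : ℝ} (hε : 0 < ε)
    (hsmall : ε * Real.log (Nat.card (ConjClasses G)) ≤ 2 / 3 * Real.log 2)
    (J : Submodule ℂ (G → ℂ)) (X Y Z : Finset G) : ¬ Witness ε G J X Y Z := by
  intro w
  have h := conjClasses_law hε w
  have hk : (1 : ℝ) ≤ (Nat.card (ConjClasses G) : ℝ) := by
    have : 0 < Nat.card (ConjClasses G) := Nat.card_pos
    exact_mod_cast this
  have hkpos : (0 : ℝ) < (Nat.card (ConjClasses G) : ℝ) := by linarith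
  -- `k^ε = exp(ε log k) ≤ exp((2/3) log 2) = 2^(2/3) < 2^((2+ε)/3)`
  have h1 : (Nat.card (ConjClasses G) : ℝ) ^ ε ≤ (2 : ℝ) ^ ((2 : ℝ) / 3) := by
    rw [Real.rpow_def_of_pos hkpos, Real.rpow_def_of_pos two_pos]
    exact Real.exp_le_exp.2 (by nlinarith)
  have h2 : (2 : ℝ) ^ ((2 : ℝ) / 3) < (2 : ℝ) ^ ((2 + ε) / 3) :=
    Real.rpow_lt_rpow_of_exponent_lt one_lt_two (by linarith)
  linarith

/-- NO FIXED HOST, `∃ ε₀` form. -/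
theorem no_fixed_host (G : Type) [Group G] [Fintype G] :
    ∃ ε₀ : ℝ, 0 < ε₀ ∧ ∀ ε : ℝ, 0 < ε → ε ≤ ε₀ →
      ∀ (J : Submodule ℂ (G → ℂ)) (X Y Z : Finset G), ¬ Witness ε G J X Y Z := by
  by_cases hk : Real.log (Nat.card (ConjClasses G)) ≤ 0
  · refine ⟨1, one_pos, fun ε hε _ J X Y Z => no_witness_of_small_eps hε ?_ J X Y Z⟩
    have : 0 < Real.log 2 := Real.log_pos one_lt_two
    nlinarith
  · push Not at hk
    refine ⟨2 / 3 * Real.log 2 / Real.log (Nat.card (ConjClasses G)), by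
      have : 0 < Real.log 2 := Real.log_pos one_lt_two
      positivity, fun ε hε hle J X Y Z => no_witness_of_small_eps hε ?_ J X Y Z⟩
    rwa [le_div_iff₀ hk] at hle

/-! ### The sharp real envelope of the graded Neumann count (for the numbers in the docblock) -/

/-- `ψ(D) := D/2 + 1/8 + √((2D + 1/2)³/54) = √(4/27)·D^(3/2)·(1 + O(D^(-1/2)))`, the real
envelope of the graded Neumann cap `max_t (tD + t² - t³)`. -/
def psi (D : ℝ) : ℝ := D / 2 + 1 / 8 + Real.sqrt ((2 * D + 1 / 2) ^ 3 / 54)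

/-- `pD + p² - p³ ≤ ψ(D)` for all real `p, D ≥ 0` (the tree's `cubic_le_real`, AM–GM, with the
optimal `B`: both side conditions hold with equality up to the sign of the square root). -/
theorem cubic_le_psi (D p : ℝ) (hD : 0 ≤ D) (hp : 0 ≤ p) : p * D + p ^ 2 - p ^ 3 ≤ psi D := by
  have hQ : 0 ≤ (2 * D + 1 / 2) ^ 3 / 54 := by positivity
  have hs0 : 0 ≤ Real.sqrt ((2 * D + 1 / 2) ^ 3 / 54) := Real.sqrt_nonneg _
  have hs := Real.sq_sqrt hQ
  refine LevelTwoBeatsCubes.Negative.cubic_le_real D (psi D) p hD hp ?_ ?_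
  · unfold psi
    linarith
  · have e : 8 * psi D - 4 * D - 1 = 8 * Real.sqrt ((2 * D + 1 / 2) ^ 3 / 54) := by
      unfold psi; ring
    rw [e, mul_pow, hs]
    exact le_of_eq (by ring)

/-- `ψ ≥ 0`. -/
theorem psi_nonneg {D : ℝ} (hD : 0 ≤ D) : 0 ≤ psi D := by
  unfold psi
  have := Real.sqrt_nonneg ((2 * D + 1 / 2) ^ 3 / 54)
  positivity

/-- REAL GRADED NEUMANN COUNT: `V ≤ ψ(dim J)` for every bi-invariant `J` and `J`-separated
triple (so `V ≤ 0.3849·D^(3/2)·(1 + o(1))`; the extremal shape is `(t, 2t, t)`, `t = √(D/3)`). -/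
theorem vol_le_psi (J : Submodule ℂ (G → ℂ)) (hJ : BiInv J) (X Y Z : Finset G)
    (h : Sep J X Y Z) : ((vol X Y Z : ℕ) : ℝ) ≤ psi (finrank ℂ J) := by
  classical
  have hD0 : (0 : ℝ) ≤ (finrank ℂ J : ℝ) := Nat.cast_nonneg _
  unfold vol
  rcases X.eq_empty_or_nonempty with rfl | ⟨x₁, hx₁⟩
  · simpa using psi_nonneg hD0
  rcases Y.eq_empty_or_nonempty with rfl | ⟨y₁, hy₁⟩
  · simpa using psi_nonneg hD0
  rcases Z.eq_empty_or_nonempty with rfl | ⟨z₁, hz₁⟩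
  · simpa using psi_nonneg hD0
  have hr : ∀ f ∈ J, ∀ t : G, (fun g => f (g * t)) ∈ J := fun f hf t => by
    simpa only [one_mul] using hJ f hf 1 t
  have hl : ∀ f ∈ J, ∀ t : G, (fun g => f (t * g)) ∈ J := fun f hf t => by
    simpa only [mul_one] using hJ f hf t 1
  have N1 := LevelTwoBeatsCubes.Negative.packing_X J hr X Y Z h hy₁ hz₁
  have N2 := LevelTwoBeatsCubes.Negative.packing_Z J hl X Y Z h hx₁ hy₁
  have ha : 1 ≤ X.card := Finset.card_pos.mpr ⟨x₁, hx₁⟩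
  have hc : 1 ≤ Z.card := Finset.card_pos.mpr ⟨z₁, hz₁⟩
  obtain ⟨b, hbY⟩ : ∃ b, Y.card = b + 1 := ⟨Y.card - 1, by
    have := Finset.card_pos.mpr ⟨y₁, hy₁⟩; omega⟩
  rw [hbY] at N1 N2 ⊢
  simp only [Nat.add_sub_cancel] at N1 N2
  set a := X.card
  set c := Z.card
  set D := finrank ℂ J
  have haR : (1 : ℝ) ≤ a := by exact_mod_cast ha
  have hcR : (1 : ℝ) ≤ c := by exact_mod_cast hc
  have hbR : (0 : ℝ) ≤ b := Nat.cast_nonneg _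
  push_cast
  rcases le_total c a with hca | hac
  · have key : c * (a * c + a * b) ≤ c * D := Nat.mul_le_mul_left _ N1
    have keyR : (c : ℝ) * (a * c + a * b) ≤ c * D := by exact_mod_cast key
    have hcaR : (c : ℝ) ≤ a := by exact_mod_cast hca
    have hint : (0 : ℝ) ≤ (c : ℝ) * ((c : ℝ) - 1) * ((a : ℝ) - c) :=
      mul_nonneg (mul_nonneg (by linarith) (by linarith)) (by linarith)
    have hV : (a : ℝ) * (b + 1) * c ≤ c * D + c ^ 2 - c ^ 3 := by nlinarith
    exact hV.trans (cubic_le_psi D c hD0 (by linarith))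
  · have key : a * (a * c + b * c) ≤ a * D := Nat.mul_le_mul_left _ N2
    have keyR : (a : ℝ) * (a * c + b * c) ≤ a * D := by exact_mod_cast key
    have hacR : (a : ℝ) ≤ c := by exact_mod_cast hac
    have hint : (0 : ℝ) ≤ (a : ℝ) * ((a : ℝ) - 1) * ((c : ℝ) - a) :=
      mul_nonneg (mul_nonneg (by linarith) (by linarith)) (by linarith)
    have hV : (a : ℝ) * (b + 1) * c ≤ a * D + a ^ 2 - a ^ 3 := by nlinarith
    exact hV.trans (cubic_le_psi D a hD0 (by linarith))

/-- THE PACKING LAW (sharp form): any witness at `ε > 0` satisfies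
`D^((2+ε)/2) < N^(ε/2) · ψ(D)^((2+ε)/3)` (`D = dim J`, `N = #(Irr ∩ J)`), i.e.
`N^ε > (D³/ψ(D)²)^((2+ε)/3) → (27/4)^((2+ε)/3)` as `D → ∞`: a witness at `ε` needs
`N ≳ 6.75^((2+ε)/(3ε)) ≈ 1.9·e^(1.27/ε)` visible blocks of comparable size (6 at `ε = 1` once
`D ≥ 200`, `7` once `D ≥ 2000`; `≈ 6·10^5` at `ε = 1/10`; `≈ 10^55` at `ε = 1/100`). -/
theorem packing_law_sharp {ε : ℝ} (hε : 0 < ε) {J : Submodule ℂ (G → ℂ)} {X Y Z : Finset G}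
    (w : Witness ε G J X Y Z) :
    (finrank ℂ J : ℝ) ^ ((2 + ε) / 2)
      < (nblocks G J : ℝ) ^ (ε / 2) * psi (finrank ℂ J) ^ ((2 + ε) / 3) := by
  have hD2 := two_le_finrank_of_witness hε w
  set D := finrank ℂ J with hDdef
  have hDpos : (0 : ℝ) < D := by exact_mod_cast (show 0 < D by omega)
  have h1 : (D : ℝ) ^ ((2 + ε) / 2) ≤ (nblocks G J : ℝ) ^ (ε / 2) * budget G J (2 + ε) :=
    (Real.rpow_le_rpow hDpos.le (finrank_le_budget_two J w.1) (by positivity)).trans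
      (budget_two_rpow_le J hε.le)
  have h2 : ((vol X Y Z : ℕ) : ℝ) ^ ((2 + ε) / 3) ≤ psi D ^ ((2 + ε) / 3) :=
    Real.rpow_le_rpow (Nat.cast_nonneg _) (vol_le_psi J w.1 X Y Z w.2.1) (by positivity)
  have hlt : budget G J (2 + ε) < ((vol X Y Z : ℕ) : ℝ) ^ ((2 + ε) / 3) := w.2.2
  have hNpos : (0 : ℝ) < (nblocks G J : ℝ) ^ (ε / 2) := by
    have hDa : (0 : ℝ) < (D : ℝ) ^ ((2 + ε) / 2) := Real.rpow_pos_of_pos hDpos _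
    by_contra hle
    push Not at hle
    have h0 : (nblocks G J : ℝ) ^ (ε / 2) = 0 :=
      le_antisymm hle (Real.rpow_nonneg (Nat.cast_nonneg _) _)
    rw [h0, zero_mul] at h1
    linarith
  exact h1.trans_lt ((mul_lt_mul_of_pos_left hlt hNpos).trans_le
    (mul_le_mul_of_nonneg_left h2 hNpos.le))

end PackingLaw

/-! ## §3c The pigeonhole bound for PROPER test spaces (graded designs are sparse) -/

section Pigeonhole

variable {G : Type} [Group G]

/-- Separation makes `(x, y) ↦ x⁻¹ y` injective on `X × Y` (read the common value against a
target `(x, z₀)`): `|X⁻¹Y| = |X|·|Y|`. [folklore] -/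
theorem card_image_XY_eq [DecidableEq G] (J : Set (G → ℂ)) (X Y Z : Finset G)
    (hsep : ∀ x₀ ∈ X, ∀ z₀ ∈ Z, ∃ f ∈ J, ∀ x ∈ X, ∀ y ∈ Y, ∀ y' ∈ Y, ∀ z ∈ Z,
      (x = x₀ ∧ y = y' ∧ z = z₀ → f (x⁻¹ * y * y'⁻¹ * z) = 1) ∧
      (¬ (x = x₀ ∧ y = y' ∧ z = z₀) → f (x⁻¹ * y * y'⁻¹ * z) = 0))
    (hZ : Z.Nonempty) :
    ((X ×ˢ Y).image fun q : G × G => q.1⁻¹ * q.2).card = X.card * Y.card := by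
  obtain ⟨z₀, hz₀⟩ := hZ
  rw [← Finset.card_product]
  refine Finset.card_image_of_injOn ?_
  rintro ⟨x, y⟩ hxy ⟨x', y'⟩ hxy' he
  simp only [Finset.coe_product, Set.mem_prod, Finset.mem_coe] at hxy hxy'
  simp only at he
  obtain ⟨f, -, hf⟩ := hsep x hxy.1 z₀ hz₀
  have h1 : f (x⁻¹ * y * y⁻¹ * z₀) = 1 := (hf x hxy.1 y hxy.2 y hxy.2 z₀ hz₀).1 ⟨rfl, rfl, rfl⟩
  have he' : x'⁻¹ * y' * y⁻¹ * z₀ = x⁻¹ * y * y⁻¹ * z₀ := by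
    rw [show x'⁻¹ * y' * y⁻¹ * z₀ = (x'⁻¹ * y') * (y⁻¹ * z₀) by group, he]; group
  have h2 := (hf x' hxy'.1 y' hxy'.2 y hxy.2 z₀ hz₀).2
  by_contra hne
  have hne' : ¬ (x' = x ∧ y' = y ∧ z₀ = z₀) := by
    rintro ⟨rfl, rfl, -⟩
    exact hne rfl
  have := h2 hne'
  rw [he', h1] at this
  exact one_ne_zero this

/-- Separation makes `(y, z) ↦ y⁻¹ z` injective on `Y × Z` (read against a target `(x₀, z)`):
`|Y⁻¹Z| = |Y|·|Z|`. [folklore] -/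
theorem card_image_YZ_eq [DecidableEq G] (J : Set (G → ℂ)) (X Y Z : Finset G)
    (hsep : ∀ x₀ ∈ X, ∀ z₀ ∈ Z, ∃ f ∈ J, ∀ x ∈ X, ∀ y ∈ Y, ∀ y' ∈ Y, ∀ z ∈ Z,
      (x = x₀ ∧ y = y' ∧ z = z₀ → f (x⁻¹ * y * y'⁻¹ * z) = 1) ∧
      (¬ (x = x₀ ∧ y = y' ∧ z = z₀) → f (x⁻¹ * y * y'⁻¹ * z) = 0))
    (hX : X.Nonempty) :
    ((Y ×ˢ Z).image fun q : G × G => q.1⁻¹ * q.2).card = Y.card * Z.card := by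
  obtain ⟨x₀, hx₀⟩ := hX
  rw [← Finset.card_product]
  refine Finset.card_image_of_injOn ?_
  rintro ⟨y, z⟩ hyz ⟨y', z'⟩ hyz' he
  simp only [Finset.coe_product, Set.mem_prod, Finset.mem_coe] at hyz hyz'
  simp only at he
  obtain ⟨f, -, hf⟩ := hsep x₀ hx₀ z hyz.2
  have h1 : f (x₀⁻¹ * y * y⁻¹ * z) = 1 := (hf x₀ hx₀ y hyz.1 y hyz.1 z hyz.2).1 ⟨rfl, rfl, rfl⟩
  have he' : x₀⁻¹ * y * y'⁻¹ * z' = x₀⁻¹ * y * y⁻¹ * z := by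
    rw [show x₀⁻¹ * y * y'⁻¹ * z' = (x₀⁻¹ * y) * (y'⁻¹ * z') by group, ← he]; group
  have h2 := (hf x₀ hx₀ y hyz.1 y' hyz'.1 z' hyz'.2).2
  by_contra hne
  have hne' : ¬ (x₀ = x₀ ∧ y = y' ∧ z' = z) := by
    rintro ⟨-, rfl, rfl⟩
    exact hne rfl
  have := h2 hne'
  rw [he', h1] at this
  exact one_ne_zero this

/-- Pigeonhole in a finite group: if `|A| + |B| > |G|` then every `g` is a product `a·b`.
[folklore] -/
theorem exists_mul_eq_of_card_lt [Fintype G] [DecidableEq G] (A B : Finset G)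
    (h : Fintype.card G < A.card + B.card) (g : G) : ∃ a ∈ A, ∃ b ∈ B, a * b = g := by
  set A' := A.image fun a => a⁻¹ * g with hA'
  have hcard : A'.card = A.card := by
    refine Finset.card_image_of_injective _ fun a₁ a₂ h12 => ?_
    simpa using h12
  have hnd : ¬ Disjoint A' B := by
    intro hd
    have := Finset.card_le_univ (A' ∪ B)
    rw [Finset.card_union_of_disjoint hd, hcard] at this
    omega
  obtain ⟨b, hb, hbA⟩ : ∃ b ∈ B, b ∈ A' := by
    simpa [Finset.not_disjoint_iff, and_comm] using hnd
  rw [hA', Finset.mem_image] at hbA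
  obtain ⟨a, ha, rfl⟩ := hbA
  exact ⟨a, ha, _, hb, by group⟩

/-- If `|X||Y| + |Y||Z| > |G|` then the separating function of any target `(x₀, z₀)` is the delta
function `δ_{x₀⁻¹z₀}` on ALL of `G` (every element is a quadruple product), so that delta function
lies in `J`. [folklore] -/
theorem single_mem_of_separated_of_card_lt [Fintype G] [DecidableEq G] (J : Submodule ℂ (G → ℂ))
    (X Y Z : Finset G)
    (hsep : ∀ x₀ ∈ X, ∀ z₀ ∈ Z, ∃ f ∈ J, ∀ x ∈ X, ∀ y ∈ Y, ∀ y' ∈ Y, ∀ z ∈ Z,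
      (x = x₀ ∧ y = y' ∧ z = z₀ → f (x⁻¹ * y * y'⁻¹ * z) = 1) ∧
      (¬ (x = x₀ ∧ y = y' ∧ z = z₀) → f (x⁻¹ * y * y'⁻¹ * z) = 0))
    (hlt : Fintype.card G < X.card * Y.card + Y.card * Z.card)
    {x₀ z₀ : G} (hx₀ : x₀ ∈ X) (hz₀ : z₀ ∈ Z) :
    (Pi.single (x₀⁻¹ * z₀) (1 : ℂ) : G → ℂ) ∈ J := by
  have hsep' : ∀ x₀ ∈ X, ∀ z₀ ∈ Z, ∃ f ∈ (J : Set (G → ℂ)), ∀ x ∈ X, ∀ y ∈ Y, ∀ y' ∈ Y, ∀ z ∈ Z,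
      (x = x₀ ∧ y = y' ∧ z = z₀ → f (x⁻¹ * y * y'⁻¹ * z) = 1) ∧
      (¬ (x = x₀ ∧ y = y' ∧ z = z₀) → f (x⁻¹ * y * y'⁻¹ * z) = 0) := hsep
  rw [← card_image_XY_eq (J : Set (G → ℂ)) X Y Z hsep' ⟨z₀, hz₀⟩,
    ← card_image_YZ_eq (J : Set (G → ℂ)) X Y Z hsep' ⟨x₀, hx₀⟩] at hlt
  obtain ⟨f, hfJ, hf⟩ := hsep x₀ hx₀ z₀ hz₀
  suffices heq : (Pi.single (x₀⁻¹ * z₀) (1 : ℂ) : G → ℂ) = f by rw [heq]; exact hfJ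
  funext g
  obtain ⟨a, ha, b, hb, hab⟩ := exists_mul_eq_of_card_lt _ _ hlt g
  rw [Finset.mem_image] at ha hb
  obtain ⟨⟨x, y⟩, hxy, rfl⟩ := ha
  obtain ⟨⟨y', z⟩, hyz, rfl⟩ := hb
  rw [Finset.mem_product] at hxy hyz
  simp only at hab hxy hyz
  have hg : x⁻¹ * y * y'⁻¹ * z = g := by rw [← hab]; group
  have hval := hf x hxy.1 y hxy.2 y' hyz.1 z hyz.2
  rw [hg] at hval
  by_cases h : g = x₀⁻¹ * z₀
  · subst h
    rw [Pi.single_eq_same]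
    -- value `1` from the target quadruple `(x₀, y, y, z₀)`
    have h1 := (hf x₀ hx₀ y hxy.2 y hxy.2 z₀ hz₀).1 ⟨rfl, rfl, rfl⟩
    rw [show x₀⁻¹ * y * y⁻¹ * z₀ = x₀⁻¹ * z₀ by group] at h1
    exact h1.symm
  · rw [Pi.single_eq_of_ne h]
    refine (hval.2 ?_).symm
    rintro ⟨rfl, rfl, rfl⟩
    exact h (by rw [← hg]; group)

/-- A bi-invariant `J` containing ONE delta function contains all of them, hence is everything.
[folklore] -/
theorem eq_top_of_biInv_of_single_mem [Fintype G] [DecidableEq G] (J : Submodule ℂ (G → ℂ))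
    (hJ : ∀ f ∈ J, ∀ a b : G, (fun g : G => f (a * g * b)) ∈ J) {t : G}
    (ht : (Pi.single t (1 : ℂ) : G → ℂ) ∈ J) : J = ⊤ := by
  have hs : ∀ s : G, (Pi.single s (1 : ℂ) : G → ℂ) ∈ J := by
    intro s
    have h := hJ _ ht 1 (s⁻¹ * t)
    have heq : (fun g : G => (Pi.single t (1 : ℂ) : G → ℂ) (1 * g * (s⁻¹ * t)))
        = (Pi.single s (1 : ℂ) : G → ℂ) := by
      funext g
      by_cases hg : g = s
      · subst hg
        simp
      · have : 1 * g * (s⁻¹ * t) ≠ t := by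
          intro h'
          apply hg
          have : g * s⁻¹ = 1 := by
            have h'' : g * s⁻¹ * t = t := by simpa [mul_assoc] using h'
            exact mul_right_cancel (h''.trans (one_mul t).symm)
          exact mul_inv_eq_one.mp this
        rw [Pi.single_eq_of_ne this, Pi.single_eq_of_ne hg]
    rw [heq] at h
    exact h
  rw [eq_top_iff]
  intro f _
  have hf : f = ∑ s : G, f s • (Pi.single s (1 : ℂ) : G → ℂ) := by
    funext g
    simp [Finset.sum_apply, Pi.single_apply]
  rw [hf]
  exact Submodule.sum_mem _ fun s _ => Submodule.smul_mem _ _ (hs s)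

/-- **Pigeonhole bound for graded designs.**  For a finite group `G`, a bi-invariant PROPER test
space `J ≠ ⊤` and a `J`-separated triple with `X, Z ≠ ∅`: `|X|·|Y| + |Y|·|Z| ≤ |G|`.
(Otherwise `X⁻¹Y · Y⁻¹Z = G`, a separating function is a delta function on all of `G`, and
bi-invariance forces `J = ℂ^G` — the full Cohn–Umans budget, no grading.) [folklore] -/
theorem card_mul_add_card_mul_le_card [Fintype G] (J : Submodule ℂ (G → ℂ))
    (hJ : ∀ f ∈ J, ∀ a b : G, (fun g : G => f (a * g * b)) ∈ J) (hJtop : J ≠ ⊤)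
    (X Y Z : Finset G)
    (hsep : ∀ x₀ ∈ X, ∀ z₀ ∈ Z, ∃ f ∈ J, ∀ x ∈ X, ∀ y ∈ Y, ∀ y' ∈ Y, ∀ z ∈ Z,
      (x = x₀ ∧ y = y' ∧ z = z₀ → f (x⁻¹ * y * y'⁻¹ * z) = 1) ∧
      (¬ (x = x₀ ∧ y = y' ∧ z = z₀) → f (x⁻¹ * y * y'⁻¹ * z) = 0))
    (hX : X.Nonempty) (hZ : Z.Nonempty) :
    X.card * Y.card + Y.card * Z.card ≤ Fintype.card G := by
  classical
  by_contra hlt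
  push Not at hlt
  obtain ⟨x₀, hx₀⟩ := hX
  obtain ⟨z₀, hz₀⟩ := hZ
  exact hJtop (eq_top_of_biInv_of_single_mem J hJ
    (single_mem_of_separated_of_card_lt J X Y Z hsep hlt hx₀ hz₀))

/-- Contrapositive, design form: a `J`-separated triple with `|X||Y| + |Y||Z| > |G|` sees the
FULL budget — every irreducible character lies in `J`. [folklore] -/
theorem irrChars_subset_of_card_lt [Fintype G] (J : Submodule ℂ (G → ℂ))
    (hJ : ∀ f ∈ J, ∀ a b : G, (fun g : G => f (a * g * b)) ∈ J) (X Y Z : Finset G)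
    (hsep : ∀ x₀ ∈ X, ∀ z₀ ∈ Z, ∃ f ∈ J, ∀ x ∈ X, ∀ y ∈ Y, ∀ y' ∈ Y, ∀ z ∈ Z,
      (x = x₀ ∧ y = y' ∧ z = z₀ → f (x⁻¹ * y * y'⁻¹ * z) = 1) ∧
      (¬ (x = x₀ ∧ y = y' ∧ z = z₀) → f (x⁻¹ * y * y'⁻¹ * z) = 0))
    (hX : X.Nonempty) (hZ : Z.Nonempty) (hlt : Fintype.card G < X.card * Y.card + Y.card * Z.card) :
    Literature.RepresentationTheory.FiniteGroups.irrChars G ∩ (J : Set (G → ℂ))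
      = Literature.RepresentationTheory.FiniteGroups.irrChars G := by
  have htop : J = ⊤ := by
    by_contra hne
    exact absurd (card_mul_add_card_mul_le_card J hJ hne X Y Z hsep hX hZ) (not_le.2 hlt)
  rw [htop]
  simp


/-- Design form with the abbreviations: a witness with a PROPER `J` has `|X||Y| + |Y||Z| ≤ |G|`. -/
theorem card_mul_add_card_mul_le_card_of_witness [Fintype G] {ε : ℝ} (hε : 0 < ε)
    {J : Submodule ℂ (G → ℂ)} {X Y Z : Finset G} (w : Witness ε G J X Y Z) (hJtop : J ≠ ⊤) :
    X.card * Y.card + Y.card * Z.card ≤ Fintype.card G := by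
  have hV := vol_pos_of_witness hε w
  unfold vol at hV
  have hX : X.Nonempty := Finset.card_pos.1 (Nat.pos_of_ne_zero fun h => by simp [h] at hV)
  have hZ : Z.Nonempty := Finset.card_pos.1 (Nat.pos_of_ne_zero fun h => by simp [h] at hV)
  exact card_mul_add_card_mul_le_card J w.1 hJtop X Y Z w.2.1 hX hZ

end Pigeonhole

/-! ## §4 The logical position of the crux: what a kill would have to be -/

section Position

/-- A GRADED PACKING BARRIER at exponent `w`: in EVERY finite group, every bi-invariant `J` and
every `J`-separated triple obey `V^(w/3) ≤ Σᶠ_{χ ∈ Irr ∩ J} χ(1)^w`. -/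
def GradedPackingBarrier (w : ℝ) : Prop :=
  ∀ (G : Type) [Group G] [Fintype G] (J : Submodule ℂ (G → ℂ)), BiInv J →
    ∀ X Y Z : Finset G, Sep J X Y Z → ((vol X Y Z : ℕ) : ℝ) ^ (w / 3) ≤ budget G J w

/-- KILL CRITERION, exactly: refuting the crux IS proving a graded packing barrier at some FIXED
exponent `2 + ε > 2`, uniformly over all finite groups (definitional unfolding of `¬ ∀ ε ∃ …`). -/
theorem not_gradedDesignFamily_iff :
    ¬ GradedDesignFamily ↔ ∃ ε : ℝ, 0 < ε ∧ GradedPackingBarrier (2 + ε) := by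
  rw [gradedDesignFamily_iff]
  constructor
  · intro h
    by_contra hb
    apply h
    intro ε hε
    by_contra hw
    apply hb
    refine ⟨ε, hε, fun G _ _ J hJ X Y Z hsep => ?_⟩
    by_contra hlt
    push Not at hlt
    exact hw ⟨G, inferInstance, inferInstance, J, X, Y, Z, hJ, hsep, hlt⟩
  · rintro ⟨ε, hε, hb⟩ h
    obtain ⟨G, _, _, J, X, Y, Z, hJ, hsep, hlt⟩ := h ε hε
    exact absurd (hb G J hJ X Y Z hsep) (not_le.2 hlt)

/-- The barrier HOLDS at the endpoint `w = 2` (walls + Peter–Weyl, §2) … -/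
theorem gradedPackingBarrier_two : GradedPackingBarrier 2 := fun _ _ _ J hJ X Y Z hsep =>
  rpow_vol_le_budget_two J hJ X Y Z hsep

/-- … and at `w = ω(ℂ)` (the PROVED sibling crux `GradedPricing`, landed `GradedPricing_of`). -/
theorem gradedPackingBarrier_omega : GradedPackingBarrier (omega ℂ) := fun G _ _ J hJ X Y Z hsep =>
  GradedPricing.GradedPricing_of G J hJ X Y Z hsep

/-- Hence `ω(ℂ) > 2` would refute the crux outright … -/
theorem not_gradedDesignFamily_of_two_lt_omega (h : 2 < omega ℂ) : ¬ GradedDesignFamily :=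
  not_gradedDesignFamily_iff.2 ⟨omega ℂ - 2, by linarith, by
    simpa only [add_sub_cancel] using gradedPackingBarrier_omega⟩

/-- … while the crux implies `ω(ℂ) = 2` (the route's deciding theorem `closes` fed with the landed
`GradedPricing_of`).  So the crux is refutable only by `ω > 2` or by a packing barrier strictly
between the two known ones (`w = 2` true, `w = ω` true, `w = 3` FALSE in print at `J = ⊤`,
CKSU 2005 §2); at `J = ⊤` such a barrier would say "no family of finite groups proves `ω = 2`",
which Blasiak–Church–Cohn–Grochow–Umans 2017 (§1, held text p. 3) call "certainly not a foregone
conclusion" either way — an open problem, not a cheap kill. -/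
theorem omega_eq_two_of_gradedDesignFamily (h : GradedDesignFamily) : omega ℂ = 2 :=
  MatrixMultiplication_iff.1 (closes GradedPricing.GradedPricing_of h)

/-- The crux is therefore EQUIVALENT, given the tree, to: `ω(ℂ) = 2` AND no graded packing barrier
above `2` — the second conjunct is where all the content sits. -/
theorem gradedDesignFamily_iff_forall_not_barrier :
    GradedDesignFamily ↔ ∀ ε : ℝ, 0 < ε → ¬ GradedPackingBarrier (2 + ε) := by
  constructor
  · intro h ε hε hb
    exact not_gradedDesignFamily_iff.2 ⟨ε, hε, hb⟩ h
  · intro h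
    by_contra hX
    obtain ⟨ε, hε, hb⟩ := not_gradedDesignFamily_iff.1 hX
    exact h ε hε hb

end Position

/-! ## Targets (lead's stuck stubs)

None at cycle 1: `payload.stuck_stubs = []`, `payload.targets = []` (no line picked yet for this
crux; its engines are the sibling cruxes `SnLevelDesigns` 7613, `LieRankDesigns` 7614,
`LieRankBeatsCubes` 14057, `SubgroupIdentityDesigns` 14079, `LevelOneGL2Designs` 14080, each with
its own disprover). -/

/-! ## §5 Why it resists (briefing) -/

/-- WHY THE CRUX RESISTS A DISPROOF (for provers / planners; nothing to prove, `True`).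

1. NO JUNK ESCAPE EITHER WAY.  The budget is an honest finite sum of `d^(2+ε)`, `d ≥ 1`
   (`budget_eq_sum`, `one_le_re_apply_one`); empty factors give `0 < budget` false
   (`vol_pos_of_witness`); `J` must be `≥ 2`-dimensional with `≥ 2` visible blocks
   (`two_le_finrank_of_witness`, `two_le_nblocks`); the crux implies `ω = 2` through the PROVED
   `GradedPricing` (`omega_eq_two_of_gradedDesignFamily`), so it cannot be true for a silly reason,
   and its negation is a uniform packing barrier (`not_gradedDesignFamily_iff`), so it cannot be
   false for a silly reason: both known barriers (`w = 2`, `w = ω`) are consistent with it.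
2. THE CONTENT IS `ε → 0⁺` ONLY.  `ε > 1`: trivial (`witness_of_one_lt`, `Z/2`); `ε = 1`: known in
   print at `J = ⊤` (CKSU 2005 §2, `(C_n³)² ⋊ C₂` beats `Σ d³`; not formalised); `ε ≳ 0.41`: known
   in print at `J = ⊤` (CKSU 2005 USP/wreath constructions, `ω ≤ 2.41`); `ε → 0`: OPEN — at `J = ⊤`
   it is "can finite groups prove `ω = 2`", implied by the surviving CKSU 2005 "two families"
   conjecture (the strong-USP conjecture is DISPROVED, BCCGNSU 2017 Thm 1.? via ASU, held text
   arXiv:1605.06702 p. 3; two-families only in special cases, p. 6), not refuted by any catalogued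
   barrier (abelian bounded exponent, nilpotent bounded exponent, Young subgroups, Lie type at FULL
   budget — BCGPU 2023 Cor 3.4 — and the tree's NormalizerBarrier for subgroups).  Grading
   (`J ⊊ ⊤`) only ENLARGES the witness space, so the negative side is harder than that open problem.
3. WHAT ANY WITNESS MUST LOOK LIKE (kernel-checked here): non-abelian host
   (`exists_abelian_witness_iff`); `#(Irr ∩ J)^ε > 2^((2+ε)/3)` and sharper
   `N^(ε/2) ψ(D)^((2+ε)/3) > D^((2+ε)/2)` (`nblocks_law`, `packing_law_sharp`): `J` needs
   `≈ (27/4)^((2+ε)/(3ε))` blocks of comparable degree and the triple must fill a CONSTANT fraction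
   `> (Σ_J d^(2+ε) / D^(1+ε/2))^(3/(2+ε))` of the graded Neumann cap `ψ(D) ≈ 0.385 D^(3/2)`;
   hosts must grow, `k(G)^ε > 2^((2+ε)/3)` (`conjClasses_law`, `no_fixed_host`).  So the family is a
   sequence of NEAR-EXTREMAL graded packings in groups with many equidimensional irreducibles —
   exactly the profile of the route's two engines (`S_n` levels `k → ∞`, `GL_m(F_p)` Harish-Chandra
   twists), and exactly what no known construction achieves below `ε ≈ 0.41`.
4. WHAT WOULD KILL IT.  A graded packing barrier at a fixed `w ∈ (2, 3)`: e.g. a graded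
   quasirandomness bound `V ≲ D^(3/2)/d_min(J)^(1/2)` valid in ALL finite groups (false as stated for
   groups with many small irreducibles — `d_min = 1` blocks exist — so it would have to be weighted),
   or a slice-rank bound for bi-invariant quotients `ℂ[G]/J^⊥`.  Neither exists in print; both would
   be new barrier entries (`Literature/Barriers/MatrixMultiplication/`). -/
theorem whyItResists : True := trivial


end Summit.MatrixMultiplication.MatrixMultiplication.Cruxes.GradedDesignFamily.Disproof

end
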